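import Summits.BirchSwinnertonDyer.BirchSwinnertonDyer.Theorems.ClassRecordThreeEulerHalvesAtThreeCartanCarayolCuspLift
import Summits.BirchSwinnertonDyer.BirchSwinnertonDyer.Theorems.ClassRecordThreeEulerHalvesAtThreeCartanCoverCuspidalEigenPackage
import HarnessLib

/-!
# The Galois leaf (OBS) of `Lines/lattice` from five named facts: `thm61 → ESᶜ → SIGᶜ → JLᶜ → COMMᶜ → NoModThreePeriodCharacterExtension`

Theorems only (one composition, recorded BY NAME so that the line's census can cite it). Route `ClassRecordThree`, crux `EulerHalvesAtThree`
(item `stmt-BirchSwinnertonDyer-19109`), node `CartanOnePlaceDegreeLawAtThree` (line `Lines/lattice`): the certificate half (EIG′) is the tree theorem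
`InertHecke.periodCharacterCuspidalEigenPackageAtThree_holds` (LEAD tam3-p1, part E), the lifting half (LIFT′) is
`CartanCarayol.cuspidalEigenCochainLift_of_facts` (this seat) from the four Literature facts (ESᶜ) `eichlerShimura_weightTwo_rePeriod`, (SIGᶜ)
`parabolicCochain_free_and_modLift`, (JLᶜ) `jacquetLanglands_cartanCover_newform`, (COMMᶜ) `unitsHeckeFun_comm_cartanCover`, and (OBS) ⇐ thm61 + (LIFT′) + (EIG′) is
`InertHecke.noModThreePeriodCharacterExtension_of_cuspLift'`. Hence (OBS) — «no additive parabolic-null `𝔽₃`-valued extension of the period character of the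
saturated docked line to the Cartan cover group» — holds granted Deligne's Thm. 6.1 and the four print inputs, with no other hypothesis. No summit statement is
proved; BSD is proved for no curve.

## References
* [DeligneSerre1974] P. Deligne, J.-P. Serre, *Formes modulaires de poids 1*, Ann. Sci. ÉNS 7 (1974), Thm. 6.1, Lemme 6.11.
* [ShimuraIATAF1971] G. Shimura, *Introduction to the arithmetic theory of automorphic functions* (1971), Thm. 8.4, § 8.3, Prop. 8.5, Thm. 3.51.
* [Carayol1986] H. Carayol, *Sur les représentations ℓ-adiques associées aux formes modulaires de Hilbert*, Ann. Sci. ÉNS 19 (1986), Thm. (A).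
-/

set_option linter.dupNamespace false

namespace Summit.BirchSwinnertonDyer.BirchSwinnertonDyer.Theorems.CartanCarayol

open Summit.BirchSwinnertonDyer.BirchSwinnertonDyer.Theorems
open Summit.BirchSwinnertonDyer.BirchSwinnertonDyer.Theorems.CartanCover.Charext
open Literature.NumberTheory.Automorphic Literature.NumberTheory.EllipticCurves.ModularForms

/-- **(OBS) FROM FIVE NAMED FACTS.** `thm61 → ESᶜ → SIGᶜ → JLᶜ → COMMᶜ → CartanCover.Charext.NoModThreePeriodCharacterExtension`.
[DeligneSerre1974, Thm. 6.1, Lemme 6.11] [ShimuraIATAF1971, Thm. 8.4, Prop. 8.5, Thm. 3.51] [Carayol1986, Thm. (A)] [folklore: composition] -/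
theorem noModThreePeriodCharacterExtension_of_facts (h61 : DeligneSerre1974.thm61_exists_adicGaloisRep)
    (hES : eichlerShimura_weightTwo_rePeriod) (hSIG : parabolicCochain_free_and_modLift) (hJL : jacquetLanglands_cartanCover_newform)
    (hCOMM : unitsHeckeFun_comm_cartanCover) : CartanCover.Charext.NoModThreePeriodCharacterExtension :=
  InertHecke.noModThreePeriodCharacterExtension_of_cuspLift' h61 (cuspidalEigenCochainLift_of_facts hES hSIG hJL hCOMM)

/-- … and (CONG) `CongruentNewformOfLevelPrimeToCartanPlaceAtThree` from the four print inputs alone. [ShimuraIATAF1971, Thm. 8.4, Prop. 8.5, Thm. 3.51]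
[DeligneSerre1974, Lemme 6.11] [folklore: composition] -/
theorem congruentNewform_of_facts (hES : eichlerShimura_weightTwo_rePeriod) (hSIG : parabolicCochain_free_and_modLift)
    (hJL : jacquetLanglands_cartanCover_newform) (hCOMM : unitsHeckeFun_comm_cartanCover) : CongruentNewformOfLevelPrimeToCartanPlaceAtThree :=
  InertHecke.congruentNewform_of_cuspLift' (cuspidalEigenCochainLift_of_facts hES hSIG hJL hCOMM)

end Summit.BirchSwinnertonDyer.BirchSwinnertonDyer.Theorems.CartanCarayol
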